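import Literature.AlgebraicGeometry.ModuliOfAbelianVarieties.SiegelShimuraSetPrincipalDissectionLevel
import Literature.AlgebraicGeometry.Motives.FiniteCoproductVarieties
import HarnessLib

/-!
# The principal dissection of `Sh_K(GSp_δ, S^±)(ℂ)` over ABSTRACT uniformised pieces (the `pts` / `incl_unif` junction of W1)

Cell hodgecm-mathlib, rung 0 on `hDel`, W1 (the complex-side witness `SiegelComplexRecordSystem` of
`deligne1971_siegelModuliOnPoints` from the facts (F) + (U)); `B-plan/M1PRIME-DAG.md` §5 (i), B-p05 census
`CENSUS-U-W1-SiegelAnalyticUniformisation` §1 rows R4/R6/R7/R11.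

★ R60-27 `SiegelModuliDatum.exists_sigma_equiv_siegelShimuraSet` (`SiegelShimuraSetPrincipalDissection.lean`) and ★ R60-27d
`SiegelModuliDatum.exists_oneLevelRecord` read their uniformisation out of a full Siegel fine moduli DATUM
`D : SiegelModuliDatum g δ N` — but their proofs use only two of its sixteen fields: the surjectivity `unif '' 𝔥_g = S(ℂ)`
and the moduli relation «`unif Z = unif Z′` iff `Z, Z′` are `Γ_δ(N)`-related».  The rung-0 fact (U)
(`siegelModuli_complexUniformisation`, text of record v0.5: clauses (U1) component cofan, (U2+) per-piece uniformisations
with exactly these two set-theoretic clauses, (U3) junction) hands over precisely such ABSTRACT uniformised pieces of the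
complex fibre of Mumford's fine moduli scheme, one per `c ∈ (ℤ/N)ˣ`, and no datum.  This file re-runs the dissection over
abstract data, so that W1's fields `pts`, `Q := (ZMod N)ˣ`, `rep`, `incl_unif` of ★ `SiegelComplexRecordSystem` follow from
(U1) + (U2+) BY NAME, with no moduli interpretation and no abelian variety in sight ([Milne2005ShimuraVarieties] Lemma 5.13,
Thm. 5.17: the dissection is pure group theory + «`S_c(ℂ) = Γ_δ(N)∖𝔥_g`»):

* §1 `SiegelShimuraSet.mk_jOfSiegel_eq_mk_jOfSiegel_iff_of_unif_iff` — for ANY map `unif : 𝔥_g → X` whose fibres are the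
  `Γ_δ(N)`-classes (period-map form, ★ `SiegelModuliDatum.unif_eq_unif_iff` token-for-token),
  `[J(Z), rK_δ(N)] = [J(Z′), rK_δ(N)] ↔ unif Z′ = unif Z` (★ R60-11 + ★ `SiegelModuli.rel_iff_exists_smul`);
* §2 `exists_sigma_equiv_siegelShimuraSet_of_unif` — for a family of such maps `unif_c : 𝔥_g → X_c`, each onto,
  `(Σ c : (ℤ/N)ˣ, X_c) ≃ Sh_{K_δ(N)}(ℂ)` with `⟨c, unif_c Z⟩ ↦ [J(Z), r_c K_δ(N)]` for integral diagonal representatives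
  `r_c = diag(1, u_c·1)`, `u_c ≡ c (N)` (★ R60-27 §1 `exists_principalRep`, §2 disjointness, §3 ontoness — verbatim);
* §3 `exists_pts_of_isColimit_cofan_of_unif` — for a `ℂ`-scheme `Mc` exhibited as the coproduct of pieces `S_c` (a colimit
  cofan, clause (U1)) uniformised as in §2 through their complex points (clause (U2+)):
  `∃ rep (pts : Mc(ℂ) ≃ Sh_{K}(ℂ)), rep c ∈ K_δ(1) ∧ (ι c)(ℂ)(unif_c Z) = pts⁻¹ [J(Z), rep c · K]` — the fields `pts`,
  `rep`, `incl_unif` of ★ `SiegelComplexRecordSystem` at the level `K`, in the structure's own shapes (★ R60-27d pattern over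
  ★ `Motives.exists_sigmaHomeomorph_of_isColimit_cofan`).

No carrier, no named fact, theorems only.  HC_CM is proved only modulo the 7 printed citations until rung 0 closes; this
file discharges none of them.

## References
* [Milne2005ShimuraVarieties] J. S. Milne, *Introduction to Shimura varieties* (2005), §5 Lemma 5.13 p. 57, Thm. 5.17 p. 59; §6 p. 70, Thm. 6.11 p. 74.
* [MumfordFogartyKirwan1994] D. Mumford, J. Fogarty, F. Kirwan, *Geometric Invariant Theory*, Appendix to Ch. 7 §A (pp. 234–235).
* [Deligne1971TravauxShimura] P. Deligne, *Travaux de Shimura* (1971), 1.8 p. 129, 4.11–4.12 pp. 148–149, Exemple 4.16 p. 150.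
* [Lange2023AbelianVarietiesComplex] H. Lange, *Abelian Varieties over the Complex Numbers* (2023), §3.1.2 Prop. 3.1.4.
-/

set_option autoImplicit false

noncomputable section

open Matrix NumberField IsDedekindDomain CategoryTheory CategoryTheory.Limits

namespace Literature.AlgebraicGeometry.ModuliOfAbelianVarieties

open Literature.AlgebraicGeometry.Motives (SchemeOver ComplexPoints AlgPoints)
open Literature.NumberTheory.Automorphic (siegelUpperHalfSpace)
open SiegelModuli

variable {g : ℕ} {δ : Fin g → ℕ}

/-! ### §1. The fibres of `Z ↦ [J(Z), rK_δ(N)]` are the fibres of ANY map with the `Γ_δ(N)` moduli relation -/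

section Fibres

/-- **`[J(Z), rK_δ(N)] = [J(Z′), rK_δ(N)] ↔ unif Z′ = unif Z` for every map `unif` on `𝔥_g` whose fibres are the
`Γ_δ(N)`-classes** (the relation stated in the period-map currency of ★ `SiegelModuliDatum.unif_eq_unif_iff`: `unif Z = unif Z′`
iff `C ∘ Φ_Z = Φ_{Z′} ∘ M` for some `M ∈ Γ_δ(N)` and a `ℂ`-linear `C`), `N ≥ 3`, `0 < g`, `r ∈ K_δ(1)`: the group-theoretic
half ★ R60-11 `SiegelShimuraSet.mk_jOfSiegel_eq_mk_jOfSiegel_iff` composed with Lange's Prop. 3.1.4 ★ `SiegelModuli.rel_iff_exists_smul`.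
The datum version ★ `SiegelShimuraSet.mk_jOfSiegel_eq_mk_jOfSiegel_iff_unif_eq_unif` is the case `unif = D.unif`.
[cite: Milne2005ShimuraVarieties, Lemma 5.13 p. 57 (footnote 40)] [cite: Lange2023AbelianVarietiesComplex, §3.1.2 Prop. 3.1.4 (p0159–p0160)] -/
theorem SiegelShimuraSet.mk_jOfSiegel_eq_mk_jOfSiegel_iff_of_unif_iff (hδ : IsPolarizationType δ) (hg : 0 < g) {N : ℕ}
    (hN : 3 ≤ N) {X : Type*} {unif : Matrix (Fin g) (Fin g) ℂ → X}
    (hiff : ∀ Z ∈ siegelUpperHalfSpace g, ∀ Z' ∈ siegelUpperHalfSpace g,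
      unif Z = unif Z' ↔ ∃ M ∈ siegelLevelGroup δ N, ∃ C : (Fin g → ℂ) ≃ₗ[ℂ] (Fin g → ℂ),
        ∀ v : Fin g ⊕ Fin g → ℝ, C (siegelPeriodMap δ Z v) = siegelPeriodMap δ Z' (intAct M v))
    {r : gspFinAdelic δ} (hr : r ∈ principalLevelSubgroup δ 1) (Z Z' : siegelUpperHalfSpace g) :
    SiegelShimuraSet.mk δ (principalLevelSubgroup δ N) ⟨jOfSiegel δ Z, jOfSiegel_coe_mem_C0pm hδ.1 Z⟩ r =
        SiegelShimuraSet.mk δ (principalLevelSubgroup δ N) ⟨jOfSiegel δ Z', jOfSiegel_coe_mem_C0pm hδ.1 Z'⟩ r ↔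
      unif Z' = unif Z := by
  rw [SiegelShimuraSet.mk_jOfSiegel_eq_mk_jOfSiegel_iff hδ hg hN hr,
    (hiff Z' Z'.2 Z Z.2).trans (rel_iff_exists_smul hδ.1 (siegelLevelGroup_le_symplecticLatticeGroup δ N) Z'.2 Z.2)]

end Fibres

/-! ### §2. The dissection `(Σ c : (ℤ/N)ˣ, X_c) ≃ Sh_{K_δ(N)}(GSp_δ, S^±)(ℂ)` over abstract uniformised pieces -/

section Dissection

/-- **THE PRINCIPAL DISSECTION OVER ABSTRACT UNIFORMISED PIECES** ([Milne ISV] Lemma 5.13 + Thm. 5.17 for `GSp_δ` at principal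
level `N ≥ 3`): given, for every `c ∈ (ℤ/N)ˣ`, a type `X_c` and a map `unif_c : 𝔥_g → X_c` ONTO `X_c` whose fibres are the
`Γ_δ(N)`-classes (period-map form), there are `ẑ`-units `u_c` of residue `c`, integral diagonal representatives
`r_c = diag(1_g, u_c·1_g) ∈ K_δ(1)` and a BIJECTION `e : (Σ c, X_c) ≃ Sh_{K_δ(N)}(ℂ)` with `e ⟨c, unif_c Z⟩ = [J(Z), r_c K_δ(N)]`
— injective on each piece by §1, pieces disjoint by ★ R60-27 §2 `intCast_dvd_sub_of_mk_jOfSiegel_eq_mk_jOfSiegel`, onto by ★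
R60-27 §3 `SiegelShimuraSet.exists_eq_mk_jOfSiegel`.  ★ R60-27's capstone is the case `X_c = D.S(ℂ)`, `unif_c = D.unif` of one
datum; here the pieces may differ (as the components of `𝒜_{g,δ,N} ⊗ ℂ` do as schemes) and carry no moduli data.
[cite: Milne2005ShimuraVarieties, Lemma 5.13 p. 57 and Thm. 5.17 p. 59; §6 p. 70] [cite: MumfordFogartyKirwan1994, Appendix to Ch. 7 §A (p. 235)]
[cite: Deligne1971TravauxShimura, Exemple 4.16 p. 150] -/
theorem exists_sigma_equiv_siegelShimuraSet_of_unif (hδ : IsPolarizationType δ) (hg : 0 < g) {N : ℕ} (hN : 3 ≤ N)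
    {X : (ZMod N)ˣ → Type*} (unif : ∀ c : (ZMod N)ˣ, Matrix (Fin g) (Fin g) ℂ → X c)
    (hsurj : ∀ c, Set.SurjOn (unif c) (siegelUpperHalfSpace g) Set.univ)
    (hiff : ∀ c, ∀ Z ∈ siegelUpperHalfSpace g, ∀ Z' ∈ siegelUpperHalfSpace g,
      unif c Z = unif c Z' ↔ ∃ M ∈ siegelLevelGroup δ N, ∃ C : (Fin g → ℂ) ≃ₗ[ℂ] (Fin g → ℂ),
        ∀ v : Fin g ⊕ Fin g → ℝ, C (siegelPeriodMap δ Z v) = siegelPeriodMap δ Z' (intAct M v)) :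
    ∃ (u : (ZMod N)ˣ → finAdeleQˣ) (rep : (ZMod N)ˣ → gspFinAdelic δ)
      (e : (Σ c : (ZMod N)ˣ, X c) ≃ SiegelShimuraSet δ (principalLevelSubgroup δ N)),
      (∀ c, (∀ v, Valued.v ((u c : finAdeleQ) v) = 1) ∧ (u c : finAdeleQ) - ((c : ZMod N).val : ℕ) ∈ levelIdeal N ∧
        rep c ∈ principalLevelSubgroup δ 1 ∧
          IsMultiplier (typeFormOver δ finAdeleQ) (rep c : GL (Fin g ⊕ Fin g) finAdeleQ) (u c) ∧
            ((rep c : GL (Fin g ⊕ Fin g) finAdeleQ) : Matrix (Fin g ⊕ Fin g) (Fin g ⊕ Fin g) finAdeleQ) =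
              Matrix.fromBlocks 1 0 0 ((u c : finAdeleQ) • (1 : Matrix (Fin g) (Fin g) finAdeleQ))) ∧
      ∀ (c : (ZMod N)ˣ) (Z : siegelUpperHalfSpace g),
        e ⟨c, unif c Z⟩ =
          SiegelShimuraSet.mk δ (principalLevelSubgroup δ N) ⟨jOfSiegel δ Z, jOfSiegel_coe_mem_C0pm hδ.1 Z⟩ (rep c) := by
  classical
  have hN0 : N ≠ 0 := by omega
  haveI : NeZero N := ⟨hN0⟩
  -- representatives
  choose u rep hu hua hrep1 hrepmul hrepmat using fun c : (ZMod N)ˣ => exists_principalRep δ hN0 c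
  -- a section of each `unif_c` on `X_c`
  have hsec : ∀ (c : (ZMod N)ˣ) (P : X c), ∃ Z : siegelUpperHalfSpace g, unif c Z = P := fun c P => by
    obtain ⟨Z, hZ, hZP⟩ := hsurj c (Set.mem_univ P)
    exact ⟨⟨Z, hZ⟩, hZP⟩
  choose σ hσ using hsec
  -- the map
  let f : (Σ c : (ZMod N)ˣ, X c) → SiegelShimuraSet δ (principalLevelSubgroup δ N) := fun p =>
    SiegelShimuraSet.mk δ (principalLevelSubgroup δ N)
      ⟨jOfSiegel δ (σ p.1 p.2), jOfSiegel_coe_mem_C0pm hδ.1 (σ p.1 p.2)⟩ (rep p.1)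
  -- its value on uniformised points
  have hf : ∀ (c : (ZMod N)ˣ) (Z : siegelUpperHalfSpace g), f ⟨c, unif c Z⟩ =
      SiegelShimuraSet.mk δ (principalLevelSubgroup δ N) ⟨jOfSiegel δ Z, jOfSiegel_coe_mem_C0pm hδ.1 Z⟩ (rep c) := by
    intro c Z
    exact (SiegelShimuraSet.mk_jOfSiegel_eq_mk_jOfSiegel_iff_of_unif_iff hδ hg hN (hiff c) (hrep1 c)
      (σ c (unif c Z)) Z).2 ((hσ c (unif c Z)).symm ▸ rfl)
  -- injective
  have hinj : Function.Injective f := by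
    rintro ⟨c, P⟩ ⟨c', P'⟩ hPP'
    have hcc' : c = c' := by
      have hres : (N : ℤ) ∣ (((c : ZMod N).val : ℕ) : ℤ) - (((c' : ZMod N).val : ℕ) : ℤ) :=
        intCast_dvd_sub_of_mk_jOfSiegel_eq_mk_jOfSiegel hδ hg hN0 (hrep1 c) (hrep1 c') (hrepmul c) (hrepmul c') (hu c')
          (by rw [Int.cast_natCast]; exact hua c) (by rw [Int.cast_natCast]; exact hua c') hPP'
      apply Units.ext
      rw [← ZMod.natCast_zmod_val (c : ZMod N), ← ZMod.natCast_zmod_val (c' : ZMod N), ← Int.cast_natCast,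
        ← Int.cast_natCast ((c' : ZMod N).val), ZMod.intCast_eq_intCast_iff_dvd_sub]
      have := Int.dvd_neg.2 hres
      rwa [neg_sub] at this
    subst hcc'
    have hPP : unif c (σ c P') = unif c (σ c P) :=
      (SiegelShimuraSet.mk_jOfSiegel_eq_mk_jOfSiegel_iff_of_unif_iff hδ hg hN (hiff c) (hrep1 c) (σ c P) (σ c P')).1 hPP'
    rw [hσ, hσ] at hPP
    rw [hPP]
  -- surjective
  have hsurj' : Function.Surjective f := by
    intro x
    obtain ⟨c, Z, rfl⟩ := SiegelShimuraSet.exists_eq_mk_jOfSiegel hδ hN0 hu hua hrepmul x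
    exact ⟨⟨c, unif c Z⟩, hf c Z⟩
  exact ⟨u, rep, Equiv.ofBijective f ⟨hinj, hsurj'⟩, fun c => ⟨hu c, hua c, hrep1 c, hrepmul c, hrepmat c⟩,
    fun c Z => hf c Z⟩

/-- The dissection at a Siegel level `K` (`K.1 = K_δ(K.N)`, ★ `SiegelLevel.val_eq`): the same statement with
`SiegelShimuraSet δ K.1` as target and `(ZMod K.N)ˣ` as index set — the shape of the fields `Q K`, `rep K`, `pts K`.
[cite: Milne2005ShimuraVarieties, Lemma 5.13 p. 57 and Thm. 5.17 p. 59] [cite: Deligne1971TravauxShimura, Exemple 4.16 p. 150] -/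
theorem exists_sigma_equiv_siegelShimuraSet_of_unif_level (hδ : IsPolarizationType δ) (hg : 0 < g) (K : SiegelLevel δ)
    {X : (ZMod K.N)ˣ → Type*} (unif : ∀ c : (ZMod K.N)ˣ, Matrix (Fin g) (Fin g) ℂ → X c)
    (hsurj : ∀ c, Set.SurjOn (unif c) (siegelUpperHalfSpace g) Set.univ)
    (hiff : ∀ c, ∀ Z ∈ siegelUpperHalfSpace g, ∀ Z' ∈ siegelUpperHalfSpace g,
      unif c Z = unif c Z' ↔ ∃ M ∈ siegelLevelGroup δ K.N, ∃ C : (Fin g → ℂ) ≃ₗ[ℂ] (Fin g → ℂ),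
        ∀ v : Fin g ⊕ Fin g → ℝ, C (siegelPeriodMap δ Z v) = siegelPeriodMap δ Z' (intAct M v)) :
    ∃ (u : (ZMod K.N)ˣ → finAdeleQˣ) (rep : (ZMod K.N)ˣ → gspFinAdelic δ)
      (e : (Σ c : (ZMod K.N)ˣ, X c) ≃ SiegelShimuraSet δ K.1),
      (∀ c, (∀ v, Valued.v ((u c : finAdeleQ) v) = 1) ∧ (u c : finAdeleQ) - ((c : ZMod K.N).val : ℕ) ∈ levelIdeal K.N ∧
        rep c ∈ principalLevelSubgroup δ 1 ∧
          IsMultiplier (typeFormOver δ finAdeleQ) (rep c : GL (Fin g ⊕ Fin g) finAdeleQ) (u c) ∧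
            ((rep c : GL (Fin g ⊕ Fin g) finAdeleQ) : Matrix (Fin g ⊕ Fin g) (Fin g ⊕ Fin g) finAdeleQ) =
              Matrix.fromBlocks 1 0 0 ((u c : finAdeleQ) • (1 : Matrix (Fin g) (Fin g) finAdeleQ))) ∧
      ∀ (c : (ZMod K.N)ˣ) (Z : siegelUpperHalfSpace g),
        e ⟨c, unif c Z⟩ = SiegelShimuraSet.mk δ K.1 ⟨jOfSiegel δ Z, jOfSiegel_coe_mem_C0pm hδ.1 Z⟩ (rep c) := by
  rw [K.val_eq]
  exact exists_sigma_equiv_siegelShimuraSet_of_unif hδ hg K.three_le_N unif hsurj hiff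

end Dissection

/-! ### §3. The `pts` / `rep` / `incl_unif` fields of a level whose complex fibre is a coproduct of uniformised pieces -/

section Points

/-- **`pts`, `rep`, `incl_unif` AT ONE LEVEL FROM (U1) + (U2+)** — W1's junction with the uniformisation fact: let `Mc` be a
`ℂ`-scheme exhibited as the coproduct of pieces `S_c` (`c ∈ (ℤ/K.N)ˣ`, a colimit cofan `ι`), each uniformised through its
complex points by a map `unif_c : 𝔥_g → S_c(ℂ)` onto `S_c(ℂ)` whose fibres are the `Γ_δ(K.N)`-classes.  Then there are
integral representatives `rep c ∈ K_δ(1)` and a bijection `pts : Mc(ℂ) ≃ Sh_K(GSp_δ, S^±)(ℂ)` with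
`(ι c)(ℂ)(unif_c Z) = pts⁻¹ [J(Z), rep c · K]` for all `Z ∈ 𝔥_g` — literally the fields `pts K`, `rep K`, `incl_unif` of ★
`SiegelComplexRecordSystem g δ` (with `Q K := (ZMod K.N)ˣ`, `incl K := ι`), in the structure's own shapes.  Inputs: §2 and
★ `Motives.exists_sigmaHomeomorph_of_isColimit_cofan` (`Mc(ℂ) ≃ₜ Σ_c S_c(ℂ)`); ★ R60-27d `SiegelModuliDatum.exists_oneLevelRecord`
is the case `S_c := D.S`, `unif_c := D.unif`. [cite: Milne2005ShimuraVarieties, Lemma 5.13 p. 57 and §6 p. 70]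
[cite: MumfordFogartyKirwan1994, Appendix to Ch. 7 §A (p. 235)] [cite: Deligne1971TravauxShimura, 1.8 p. 129 and Exemple 4.16 p. 150] -/
theorem exists_pts_of_isColimit_cofan_of_unif (hδ : IsPolarizationType δ) (hg : 0 < g) (K : SiegelLevel δ)
    {Mc : SchemeOver ℂ} {S : (ZMod K.N)ˣ → SchemeOver ℂ} {ι : ∀ c, S c ⟶ Mc} (hc : IsColimit (Cofan.mk Mc ι))
    (unif : ∀ c : (ZMod K.N)ˣ, Matrix (Fin g) (Fin g) ℂ → ComplexPoints (S c))
    (hsurj : ∀ c, Set.SurjOn (unif c) (siegelUpperHalfSpace g) Set.univ)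
    (hiff : ∀ c, ∀ Z ∈ siegelUpperHalfSpace g, ∀ Z' ∈ siegelUpperHalfSpace g,
      unif c Z = unif c Z' ↔ ∃ M ∈ siegelLevelGroup δ K.N, ∃ C : (Fin g → ℂ) ≃ₗ[ℂ] (Fin g → ℂ),
        ∀ v : Fin g ⊕ Fin g → ℝ, C (siegelPeriodMap δ Z v) = siegelPeriodMap δ Z' (intAct M v)) :
    ∃ (rep : (ZMod K.N)ˣ → gspFinAdelic δ) (pts : ComplexPoints Mc ≃ SiegelShimuraSet δ K.1),
      (∀ c, rep c ∈ principalLevelSubgroup δ 1) ∧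
        ∀ (c : (ZMod K.N)ˣ) (Z : Matrix (Fin g) (Fin g) ℂ) (hJ : jOfSiegel δ Z ∈ C0pm δ),
          Z ∈ siegelUpperHalfSpace g →
            AlgPoints.map (ι c) (unif c Z) = pts.symm (SiegelShimuraSet.mk δ K.1 ⟨jOfSiegel δ Z, hJ⟩ (rep c)) := by
  classical
  obtain ⟨u, rep, e, hrep, he⟩ := exists_sigma_equiv_siegelShimuraSet_of_unif_level hδ hg K unif hsurj hiff
  obtain ⟨Φ, hΦ⟩ := Motives.exists_sigmaHomeomorph_of_isColimit_cofan ℂ hc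
  refine ⟨rep, Φ.toEquiv.symm.trans e, fun c => (hrep c).2.2.1, fun c Z hJ hZ => ?_⟩
  rw [Equiv.eq_symm_apply, Equiv.trans_apply, ← hΦ c (unif c Z)]
  have h1 : Φ.toEquiv.symm (Φ ⟨c, unif c Z⟩) = ⟨c, unif c Z⟩ := Φ.toEquiv.symm_apply_apply _
  rw [h1]
  exact he c ⟨Z, hZ⟩

/-- … together with the pieces' `rep`-data spelled out (`u_c ∈ ẑ^×`, `u_c ≡ c (N)`, `ν(rep c) = u_c`,
`rep c = diag(1, u_c·1)`) and the POINTWISE READING of `pts`: every complex point of `Mc` is `(ι c)(ℂ)(unif_c Z)` for some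
piece `c` and `Z ∈ 𝔥_g`, with `pts`-value `[J(Z), rep c · K]` — the form W1's `map_pts` and W3's `IsModuli` consume (★
R60-27b/27c `restrict_mk_diag_eq_mk_diag_level` reads transitions on exactly these representatives).
[cite: Milne2005ShimuraVarieties, Thm. 5.17 p. 59 and §6 p. 70] [cite: Deligne1971TravauxShimura, 1.8 p. 129] -/
theorem exists_pts_of_isColimit_cofan_of_unif' (hδ : IsPolarizationType δ) (hg : 0 < g) (K : SiegelLevel δ)
    {Mc : SchemeOver ℂ} {S : (ZMod K.N)ˣ → SchemeOver ℂ} {ι : ∀ c, S c ⟶ Mc} (hc : IsColimit (Cofan.mk Mc ι))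
    (unif : ∀ c : (ZMod K.N)ˣ, Matrix (Fin g) (Fin g) ℂ → ComplexPoints (S c))
    (hsurj : ∀ c, Set.SurjOn (unif c) (siegelUpperHalfSpace g) Set.univ)
    (hiff : ∀ c, ∀ Z ∈ siegelUpperHalfSpace g, ∀ Z' ∈ siegelUpperHalfSpace g,
      unif c Z = unif c Z' ↔ ∃ M ∈ siegelLevelGroup δ K.N, ∃ C : (Fin g → ℂ) ≃ₗ[ℂ] (Fin g → ℂ),
        ∀ v : Fin g ⊕ Fin g → ℝ, C (siegelPeriodMap δ Z v) = siegelPeriodMap δ Z' (intAct M v)) :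
    ∃ (u : (ZMod K.N)ˣ → finAdeleQˣ) (rep : (ZMod K.N)ˣ → gspFinAdelic δ)
      (pts : ComplexPoints Mc ≃ SiegelShimuraSet δ K.1),
      (∀ c, (∀ v, Valued.v ((u c : finAdeleQ) v) = 1) ∧ (u c : finAdeleQ) - ((c : ZMod K.N).val : ℕ) ∈ levelIdeal K.N ∧
        rep c ∈ principalLevelSubgroup δ 1 ∧
          IsMultiplier (typeFormOver δ finAdeleQ) (rep c : GL (Fin g ⊕ Fin g) finAdeleQ) (u c) ∧
            ((rep c : GL (Fin g ⊕ Fin g) finAdeleQ) : Matrix (Fin g ⊕ Fin g) (Fin g ⊕ Fin g) finAdeleQ) =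
              Matrix.fromBlocks 1 0 0 ((u c : finAdeleQ) • (1 : Matrix (Fin g) (Fin g) finAdeleQ))) ∧
      (∀ P : ComplexPoints Mc, ∃ (c : (ZMod K.N)ˣ) (Z : siegelUpperHalfSpace g),
          P = AlgPoints.map (ι c) (unif c Z) ∧
            pts P = SiegelShimuraSet.mk δ K.1 ⟨jOfSiegel δ Z, jOfSiegel_coe_mem_C0pm hδ.1 Z⟩ (rep c)) ∧
        ∀ (c : (ZMod K.N)ˣ) (Z : Matrix (Fin g) (Fin g) ℂ) (hJ : jOfSiegel δ Z ∈ C0pm δ),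
          Z ∈ siegelUpperHalfSpace g →
            AlgPoints.map (ι c) (unif c Z) = pts.symm (SiegelShimuraSet.mk δ K.1 ⟨jOfSiegel δ Z, hJ⟩ (rep c)) := by
  classical
  obtain ⟨u, rep, e, hrep, he⟩ := exists_sigma_equiv_siegelShimuraSet_of_unif_level hδ hg K unif hsurj hiff
  obtain ⟨Φ, hΦ⟩ := Motives.exists_sigmaHomeomorph_of_isColimit_cofan ℂ hc
  have hval : ∀ (c : (ZMod K.N)ˣ) (Z : siegelUpperHalfSpace g),
      (Φ.toEquiv.symm.trans e) (AlgPoints.map (ι c) (unif c Z)) =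
        SiegelShimuraSet.mk δ K.1 ⟨jOfSiegel δ Z, jOfSiegel_coe_mem_C0pm hδ.1 Z⟩ (rep c) := fun c Z => by
    rw [Equiv.trans_apply, ← hΦ c (unif c Z)]
    have h1 : Φ.toEquiv.symm (Φ ⟨c, unif c Z⟩) = ⟨c, unif c Z⟩ := Φ.toEquiv.symm_apply_apply _
    rw [h1]
    exact he c Z
  refine ⟨u, rep, Φ.toEquiv.symm.trans e, hrep, fun P => ?_, fun c Z hJ hZ => ?_⟩
  · obtain ⟨⟨c, Q⟩, hcQ⟩ := Φ.surjective P
    obtain ⟨Z, hZ, hZQ⟩ := hsurj c (Set.mem_univ Q)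
    refine ⟨c, ⟨Z, hZ⟩, ?_, ?_⟩
    · rw [← hcQ, hΦ, ← hZQ]
    · rw [← hcQ, hΦ, ← hZQ]
      exact hval c ⟨Z, hZ⟩
  · rw [Equiv.eq_symm_apply]
    exact hval c ⟨Z, hZ⟩

end Points

end Literature.AlgebraicGeometry.ModuliOfAbelianVarieties

end
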